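import Summits.QuantumFields.BalabanUV.T4Continuum.Spine.NE2.OneStepRemainder

/-!
# T⁴ programme, spine node NE2 (U1a) — R14 W3 proper, file 2: THE DOMINATION (139) OF [B7] (124)'s REMAINDER BY THE KERNEL (140), AND ITS OPERATOR SIZE
# (cell `pub-balaban-gaps`, seat ne2 gen 5; companion of `OneStepRemainder`)

[B7] p. 39: «From (124) it is clear that we have the inequalities |Q_{V₀}A| ≤ Q|A|, |Q″(V₀)A| ≤ C′₁L²α₀Q″|A|, (139) where the operator Q is defined as in [2], and Q″ is defined as
(Q″A)_c = Σ_{b⊂B(c₋)∪B(c₊)} L^{−d}A_b. (140)  The constant C′₁ depends on d and L.»  File 1 typed the remainder `Qrem` of (124) (comb terms at `c₋`/`c₊`, coefficient-weighted line term,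
axis term; coefficient operators `G₁, G₂, G₃` and `R̄_{0,c}` as DATA with the letter `‖G_i‖ ≤ γ`, print's `γ = O(L²α₀)`) and the kernel `qtwo` of (140) with its Schur sums.  THIS FILE proves,
for contractive transporters `V`, `R̄_{0,c}`:
 * the point identities placing every bond of (124) in `B(c₋) ∪ B(c₊)` (`line_pt_eq`, **`one_le_blockInd_line`**, `axis_pt_eq`; the comb bonds are file 1's `combPt_cpt`);
 * the termwise entry bounds `norm_combOp_apply_le` (`≤ d·γ·[b₋ ∈ B(z)]`), **`norm_Qstep_apply_le`** (ANY one-step table of size `≤ γ`: `≤ γ·([b₋∈B(c₋)] + [b₋∈B(c₊)])` — the main-term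
   half of (139) at `γ = 1`, `norm_Qstep_Smain_apply_le`), `norm_axisOp_apply_le`;
 * **`norm_Qrem_apply_le`**: `‖Q″(c,α;b,α′)‖ ≤ (2d+2)·L^d·γ·qtwo c b` — (139) with `C′₁L²α₀ ↔ (2d+2)L^d·γ` (a constant depending on `d` and `L` times the coefficient letter);
 * **`opNorm_Qrem_le`**: `‖Q″(V₀)‖ ≤ card o·2d·(2d+2)L^d·γ·(√(L^d))⁻¹` by file 1's `opNorm_le_of_dominated` — the SIZE half of the `E″` datum of
   `ComposedAveragingRemainder.composed_averaging_remainder_rate` for ONE step (the composition over the levels, (141)–(143), and the two-level consistency are the successor's).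
HONEST FRAMING (T4-DAG p. 1).  Bookkeeping about a typed operator shape whose background data are DISPLAYED; NOT NE2, NOT [B9] (3.16)/(3.26) or [B7] (124) beyond the displayed reading;
**NE2 (U1a) NOT PROVED**; spine PROVED 0/9 unchanged; NOT continuum YM / infinite volume / mass gap / Clay.  HONEST DEPENDENCY: continuum YM on T⁴ ⇐ BetaPertH ∧ nine spine estimates
(0/9 proved); BetaPertH ⇐ (D1) ∧ (D4) ∧ CAP+tail.  No `sorry`.
-/

noncomputable section

open scoped BigOperators ComplexConjugate Matrix Matrix.Norms.L2Operator Kronecker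

namespace Summit.QuantumFields.BalabanUV.T4Continuum.NE2.OneStepRemainder

open Literature.MathematicalPhysics.QuantumFieldTheory.Balaban1983to89.B5Prop11Plancherel (Tor fine unitVec)
open Literature.MathematicalPhysics.QuantumFieldTheory.Balaban1983to89.B5Block118 (tstep)
open Literature.MathematicalPhysics.QuantumFieldTheory.Balaban1983to89.B5Composition116 (tstep_add)
open Literature.MathematicalPhysics.QuantumFieldTheory.Balaban1983to89.B5G183RateTorus (cpt)
open Literature.MathematicalPhysics.QuantumFieldTheory.Balaban1983to89.B5G183RateTorusW (off)
open Summit.QuantumFields.BalabanUV.T4Continuum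
open Summit.QuantumFields.BalabanUV.T4Continuum.BalabanAveragedTowerUnit (norm_entry_le_opNorm)
open Summit.QuantumFields.BalabanUV.T4Continuum.ScalarMassTower (cpt_add_unitVec)
open Summit.QuantumFields.BalabanUV.T4Continuum.LineAveragingTwoLevel (off_update)
open Summit.QuantumFields.BalabanUV.T4Continuum.CovariantBlockAveraging (transport leg)
open Summit.QuantumFields.BalabanUV.T4Continuum.CovariantVectorChartModulus (norm_transport_le_one)
open Summit.QuantumFields.BalabanUV.T4Continuum.NE2.ComposedAveragingIdentity (Qstep)

variable {d : ℕ} (n L : ℕ) [NeZero n] [NeZero L] (M : Fin d → ℕ) [hM : ∀ μ, NeZero (M μ)] {o : Type*} [Fintype o] [DecidableEq o]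

/-! ## §3 (of the W3 plan) The domination (139) and the operator size -/

section Domination

variable [Nonempty o] {V : Fin d → (Tor (fine (L * n) M) × Fin d → Matrix o o ℂ)} {γ : ℝ}

omit [Nonempty o] in
/-- the entry of `w·(G·T)` is at most `|w|·γ` for `‖G‖ ≤ γ` and a contractive `T`. [folklore] -/
theorem norm_coeff_entry_le {G T : Matrix o o ℂ} (hG : ‖G‖ ≤ γ) (hT : ‖T‖ ≤ 1) (w : ℂ) (α α' : o) :
    ‖w * (G * T) α α'‖ ≤ ‖w‖ * γ := by
  have h0 : 0 ≤ γ := (norm_nonneg _).trans hG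
  rw [norm_mul]
  refine mul_le_mul_of_nonneg_left ?_ (norm_nonneg _)
  calc ‖(G * T) α α'‖ ≤ ‖G * T‖ := norm_entry_le_opNorm _ _ _
    _ ≤ ‖G‖ * ‖T‖ := norm_mul_le _ _
    _ ≤ γ * 1 := mul_le_mul hG hT (norm_nonneg _) h0
    _ = γ := mul_one γ

omit [NeZero n] hM in
/-- the line point `L·x + r + s e_μ` re-based on the `μ`-axis: `= L·x + r[μ ↦ 0] + (r_μ + s) e_μ`. [folklore] -/
theorem line_pt_eq (x : Tor (fine n M)) (r : Fin d → Fin L) (μ : Fin d) (s : ℕ) :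
    cpt n L M x + off n L M r + tstep (fine (L * n) M) μ s
      = cpt n L M x + off n L M (Function.update r μ 0) + tstep (fine (L * n) M) μ ((r μ : ℕ) + s) := by
  have h : off n L M r = off n L M (Function.update r μ 0) + tstep (fine (L * n) M) μ (r μ : ℕ) := by
    conv_lhs => rw [← Function.update_eq_self μ r]
    exact off_update n L M r μ (r μ)
  rw [h, tstep_add]; abel

/-- **LINE BONDS LIE IN `B(c₋) ∪ B(c₊)`**: `1 ≤ [L·x + r + s e_μ ∈ B(x)] + [L·x + r + s e_μ ∈ B(x + e_μ)]` for `s < L`. [folklore] -/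
theorem one_le_blockInd_line (x : Tor (fine n M)) (r : Fin d → Fin L) (μ : Fin d) (s : Fin L) :
    1 ≤ blockInd n L M x (cpt n L M x + off n L M r + tstep (fine (L * n) M) μ (s : ℕ))
        + blockInd n L M (x + unitVec (fine n M) μ) (cpt n L M x + off n L M r + tstep (fine (L * n) M) μ (s : ℕ)) := by
  rw [line_pt_eq]
  by_cases h : (r μ : ℕ) + (s : ℕ) < L
  · have e : cpt n L M x + off n L M (Function.update r μ 0) + tstep (fine (L * n) M) μ ((r μ : ℕ) + (s : ℕ))
        = cpt n L M x + off n L M (Function.update r μ ⟨(r μ : ℕ) + (s : ℕ), h⟩) := by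
      rw [off_update n L M r μ ⟨(r μ : ℕ) + (s : ℕ), h⟩, add_assoc]
    rw [e, blockInd_cpt_add_off]
    linarith [blockInd_nonneg n L M (x + unitVec (fine n M) μ) (cpt n L M x + off n L M (Function.update r μ ⟨(r μ : ℕ) + (s : ℕ), h⟩))]
  · rw [not_lt] at h
    obtain ⟨q, hq, hqs⟩ : ∃ q : ℕ, q < L ∧ (r μ : ℕ) + (s : ℕ) = L + q :=
      ⟨(r μ : ℕ) + (s : ℕ) - L, by have := (r μ).isLt; have := s.isLt; omega, by omega⟩
    have e : cpt n L M x + off n L M (Function.update r μ 0) + tstep (fine (L * n) M) μ ((r μ : ℕ) + (s : ℕ))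
        = cpt n L M (x + unitVec (fine n M) μ) + off n L M (Function.update r μ ⟨q, hq⟩) := by
      rw [cpt_add_unitVec, off_update n L M r μ ⟨q, hq⟩, hqs, tstep_add]
      abel
    rw [e, blockInd_cpt_add_off]
    linarith [blockInd_nonneg n L M x (cpt n L M (x + unitVec (fine n M) μ) + off n L M (Function.update r μ ⟨q, hq⟩))]

omit [NeZero n] hM in
/-- axis points are block points: `L·x + s e_μ = L·x + (s e_μ as an offset)` for `s < L`. [folklore] -/
theorem axis_pt_eq (x : Tor (fine n M)) (μ : Fin d) (s : Fin L) :
    cpt n L M x + tstep (fine (L * n) M) μ (s : ℕ) = cpt n L M x + off n L M (Function.update (fun _ => (0 : Fin L)) μ s) := by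
  have h0 : off n L M (fun _ => (0 : Fin L)) = 0 := by funext κ; simp [off]
  rw [off_update n L M (fun _ => (0 : Fin L)) μ s, Function.update_eq_self, h0, zero_add]

/-- **COMB-TERM ENTRIES**: `‖combOp G z (c,α;b,α′)‖ ≤ d·γ·[b₋ ∈ B(z(c))]` for `‖G‖ ≤ γ` and contractive `V` (`L^d·d·L` summands of size `≤ L^{−(d+1)}γ`, all supported in the block). [folklore] -/
theorem norm_combOp_apply_le (hγ : 0 ≤ γ) (hV : ∀ ν b, ‖V ν b‖ ≤ 1) {G : Tor (fine n M) → Fin d → (Fin d → Fin L) → Matrix o o ℂ}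
    (hG : ∀ x μ r, ‖G x μ r‖ ≤ γ) (z : Tor (fine n M) × Fin d → Tor (fine n M)) (b : (Tor (fine n M) × Fin d) × o) (i : (Tor (fine (L * n) M) × Fin d) × o) :
    ‖combOp n L M V G z b i‖ ≤ d * γ * blockInd n L M (z b.1) i.1.1 := by
  have hL0 : (0 : ℝ) < L := by exact_mod_cast Nat.pos_of_ne_zero (NeZero.ne L)
  have hB := blockInd_nonneg n L M (z b.1) i.1.1
  have hw : ‖(1 / (L : ℂ) ^ (d + 1))‖ = ((L : ℝ) ^ (d + 1))⁻¹ := by rw [one_div, norm_inv, norm_pow, Complex.norm_natCast]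
  have hterm : ∀ (r : Fin d → Fin L) (ν : Fin d) (p : Fin L),
      ‖(if (p : ℕ) < (r ν : ℕ) ∧ i.1 = (combPt n L M (cpt n L M (z b.1)) r ν p, ν) then
          (1 / (L : ℂ) ^ (d + 1)) * (G b.1.1 b.1.2 r * transport (fine (L * n) M) V b.1.2 (combPrefix n L M (cpt n L M (z b.1)) r ν p)) b.2 i.2
        else 0)‖ ≤ ((L : ℝ) ^ (d + 1))⁻¹ * γ * blockInd n L M (z b.1) i.1.1 := by
    intro r ν p
    split_ifs with h
    · have hB1 : blockInd n L M (z b.1) i.1.1 = 1 := by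
        rw [show i.1.1 = combPt n L M (cpt n L M (z b.1)) r ν p from congrArg Prod.fst h.2, combPt_cpt, blockInd_cpt_add_off]
      rw [hB1, mul_one, ← hw]
      exact norm_coeff_entry_le (hG _ _ _) (norm_transport_le_one _ hV _ _) _ _ _
    · rw [norm_zero]; positivity
  calc ‖combOp n L M V G z b i‖
      ≤ ∑ r : Fin d → Fin L, ∑ ν : Fin d, ∑ p : Fin L, ((L : ℝ) ^ (d + 1))⁻¹ * γ * blockInd n L M (z b.1) i.1.1 := by
        rw [combOp]
        refine (norm_sum_le _ _).trans (Finset.sum_le_sum fun r _ => (norm_sum_le _ _).trans (Finset.sum_le_sum fun ν _ =>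
          (norm_sum_le _ _).trans (Finset.sum_le_sum fun p _ => hterm r ν p)))
    _ = d * γ * blockInd n L M (z b.1) i.1.1 := by
        simp only [Finset.sum_const, Finset.card_univ, Fintype.card_fin, nsmul_eq_mul]
        rw [Fintype.card_fun, Fintype.card_fin, Fintype.card_fin]
        push_cast
        field_simp
        ring

omit [Nonempty o] in
/-- **LINE-TERM ENTRIES**: for ANY one-step table with `‖S‖ ≤ γ`, `‖Qstep S (c,α;b,α′)‖ ≤ γ·([b₋ ∈ B(c₋)] + [b₋ ∈ B(c₊)])` — in particular the main term (139) «|Q_{V₀}A| ≤ Q|A|»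
(`γ = 1`) and the third term of (124) (`S = G₁·Smain`). [cite: Balaban1985Averaging, (139) p.39] [folklore] -/
theorem norm_Qstep_apply_le (hγ : 0 ≤ γ) {S : Tor (fine n M) → (Fin d → Fin L) → Fin d → ℕ → Matrix o o ℂ} (hS : ∀ x r μ (s : Fin L), ‖S x r μ s‖ ≤ γ)
    (b : (Tor (fine n M) × Fin d) × o) (i : (Tor (fine (L * n) M) × Fin d) × o) :
    ‖Qstep n L M S b i‖ ≤ γ * (blockInd n L M b.1.1 i.1.1 + blockInd n L M (b.1.1 + unitVec (fine n M) b.1.2) i.1.1) := by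
  have hL0 : (0 : ℝ) < L := by exact_mod_cast Nat.pos_of_ne_zero (NeZero.ne L)
  set B := blockInd n L M b.1.1 i.1.1 + blockInd n L M (b.1.1 + unitVec (fine n M) b.1.2) i.1.1 with hBdef
  have hB : 0 ≤ B := add_nonneg (blockInd_nonneg n L M _ _) (blockInd_nonneg n L M _ _)
  have hw : ‖(1 / (L : ℂ) ^ (d + 1))‖ = ((L : ℝ) ^ (d + 1))⁻¹ := by rw [one_div, norm_inv, norm_pow, Complex.norm_natCast]
  rw [Qstep]
  by_cases hμ : i.1.2 = b.1.2
  · rw [if_pos hμ]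
    have hterm : ∀ (r : Fin d → Fin L) (s : Fin L),
        ‖(if i.1.1 = cpt n L M b.1.1 + off n L M r + tstep (fine (L * n) M) b.1.2 (s : ℕ) then (1 / (L : ℂ) ^ (d + 1)) * S b.1.1 r b.1.2 s b.2 i.2 else 0)‖
          ≤ ((L : ℝ) ^ (d + 1))⁻¹ * γ * B := by
      intro r s
      split_ifs with h
      · have hB1 : 1 ≤ B := by rw [hBdef, h]; exact one_le_blockInd_line n L M b.1.1 r b.1.2 s
        rw [norm_mul, hw]
        calc ((L : ℝ) ^ (d + 1))⁻¹ * ‖S b.1.1 r b.1.2 s b.2 i.2‖ ≤ ((L : ℝ) ^ (d + 1))⁻¹ * γ * 1 := by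
              rw [mul_one]; exact mul_le_mul_of_nonneg_left ((norm_entry_le_opNorm _ _ _).trans (hS _ _ _ _)) (by positivity)
          _ ≤ ((L : ℝ) ^ (d + 1))⁻¹ * γ * B := by gcongr
      · rw [norm_zero]; positivity
    calc ‖∑ r : Fin d → Fin L, ∑ s : Fin L, (if i.1.1 = cpt n L M b.1.1 + off n L M r + tstep (fine (L * n) M) b.1.2 (s : ℕ) then
            (1 / (L : ℂ) ^ (d + 1)) * S b.1.1 r b.1.2 s b.2 i.2 else 0)‖
        ≤ ∑ r : Fin d → Fin L, ∑ s : Fin L, ((L : ℝ) ^ (d + 1))⁻¹ * γ * B :=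
          (norm_sum_le _ _).trans (Finset.sum_le_sum fun r _ => (norm_sum_le _ _).trans (Finset.sum_le_sum fun s _ => hterm r s))
      _ = γ * B := by
          simp only [Finset.sum_const, Finset.card_univ, Fintype.card_fin, nsmul_eq_mul]
          rw [Fintype.card_fun, Fintype.card_fin, Fintype.card_fin]
          push_cast
          field_simp
          ring
  · rw [if_neg hμ, norm_zero]; positivity

/-- **AXIS-TERM ENTRIES**: `‖axisOp G₃ (c,α;b,α′)‖ ≤ γ·[b₋ ∈ B(c₋)]`. [folklore] -/
theorem norm_axisOp_apply_le (hγ : 0 ≤ γ) (hV : ∀ ν b, ‖V ν b‖ ≤ 1) {G₃ : Tor (fine n M) → Fin d → Matrix o o ℂ} (hG₃ : ∀ x μ, ‖G₃ x μ‖ ≤ γ)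
    (b : (Tor (fine n M) × Fin d) × o) (i : (Tor (fine (L * n) M) × Fin d) × o) :
    ‖axisOp n L M V G₃ b i‖ ≤ γ * blockInd n L M b.1.1 i.1.1 := by
  have hL0 : (0 : ℝ) < L := by exact_mod_cast Nat.pos_of_ne_zero (NeZero.ne L)
  have hB := blockInd_nonneg n L M b.1.1 i.1.1
  have hw : ‖(1 / (L : ℂ))‖ = (L : ℝ)⁻¹ := by rw [one_div, norm_inv, Complex.norm_natCast]
  have hterm : ∀ s : Fin L,
      ‖(if i.1 = (cpt n L M b.1.1 + tstep (fine (L * n) M) b.1.2 (s : ℕ), b.1.2) then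
          (1 / (L : ℂ)) * (G₃ b.1.1 b.1.2 * transport (fine (L * n) M) V b.1.2 (leg (L * n) M b.1.2 (cpt n L M b.1.1) (s : ℕ))) b.2 i.2 else 0)‖
        ≤ (L : ℝ)⁻¹ * γ * blockInd n L M b.1.1 i.1.1 := by
    intro s
    split_ifs with h
    · have hB1 : blockInd n L M b.1.1 i.1.1 = 1 := by
        rw [show i.1.1 = cpt n L M b.1.1 + tstep (fine (L * n) M) b.1.2 (s : ℕ) from congrArg Prod.fst h, axis_pt_eq, blockInd_cpt_add_off]
      rw [hB1, mul_one, ← hw]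
      exact norm_coeff_entry_le (hG₃ _ _) (norm_transport_le_one _ hV _ _) _ _ _
    · rw [norm_zero]; positivity
  calc ‖axisOp n L M V G₃ b i‖ ≤ ∑ s : Fin L, (L : ℝ)⁻¹ * γ * blockInd n L M b.1.1 i.1.1 := by
        rw [axisOp]; exact (norm_sum_le _ _).trans (Finset.sum_le_sum fun s _ => hterm s)
    _ = γ * blockInd n L M b.1.1 i.1.1 := by
        simp only [Finset.sum_const, Finset.card_univ, Fintype.card_fin, nsmul_eq_mul]
        field_simp

/-- **THE DOMINATION (139)**: «|Q″(V₀)A| ≤ C′₁L²α₀Q″|A| … The constant C′₁ depends on d and L» — here `‖Q″(c,α;b,α′)‖ ≤ (2d+2)·L^d·γ·qtwo c b` for contractive transporters `V`,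
`R̄_{0,c}` and coefficient operators of size `≤ γ` (print's `γ = O(L²α₀)`). [cite: Balaban1985Averaging, (139)–(140) p.39] [folklore] -/
theorem norm_Qrem_apply_le (hγ : 0 ≤ γ) (hV : ∀ ν b, ‖V ν b‖ ≤ 1) {G₁ G₂ : Tor (fine n M) → Fin d → (Fin d → Fin L) → Matrix o o ℂ}
    {G₃ Rc : Tor (fine n M) → Fin d → Matrix o o ℂ} (hG₁ : ∀ x μ r, ‖G₁ x μ r‖ ≤ γ) (hG₂ : ∀ x μ r, ‖G₂ x μ r‖ ≤ γ) (hG₃ : ∀ x μ, ‖G₃ x μ‖ ≤ γ)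
    (hRc : ∀ x μ, ‖Rc x μ‖ ≤ 1) (b : (Tor (fine n M) × Fin d) × o) (i : (Tor (fine (L * n) M) × Fin d) × o) :
    ‖Qrem n L M V G₁ G₂ G₃ Rc b i‖ ≤ (2 * d + 2) * (L : ℝ) ^ d * γ * qtwo n L M b.1 i.1 := by
  have hd : (0 : ℝ) ≤ d := Nat.cast_nonneg _
  have hL : (0 : ℝ) < (L : ℝ) ^ d := pow_pos (by exact_mod_cast Nat.pos_of_ne_zero (NeZero.ne L)) d
  have hdγ : 0 ≤ (d : ℝ) * γ := mul_nonneg hd hγ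
  have h1 : ‖combOp n L M V G₁ (fun c => c.1) b i‖ ≤ d * γ * blockInd n L M b.1.1 i.1.1 :=
    norm_combOp_apply_le n L M hγ hV hG₁ (fun c => c.1) b i
  have hS : ∀ x r μ (s : Fin L), ‖G₁ x μ r * Smain n L M V x r μ s‖ ≤ γ := fun x r μ s =>
    (norm_mul_le _ _).trans ((mul_le_mul (hG₁ x μ r) (norm_transport_le_one _ hV _ _) (norm_nonneg _) hγ).trans (le_of_eq (mul_one γ)))
  have h2 : ‖Qstep n L M (fun x r μ s => G₁ x μ r * Smain n L M V x r μ s) b i‖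
      ≤ γ * (blockInd n L M b.1.1 i.1.1 + blockInd n L M (b.1.1 + unitVec (fine n M) b.1.2) i.1.1) :=
    norm_Qstep_apply_le n L M hγ (S := fun x r μ s => G₁ x μ r * Smain n L M V x r μ s) hS b i
  have hG₂' : ∀ x μ r, ‖-(G₂ x μ r * Rc x μ)‖ ≤ γ := fun x μ r => by
    rw [norm_neg]; exact (norm_mul_le _ _).trans ((mul_le_mul (hG₂ x μ r) (hRc x μ) (norm_nonneg _) hγ).trans (le_of_eq (mul_one γ)))
  have h3 : ‖combOp n L M V (fun x μ r => -(G₂ x μ r * Rc x μ)) (fun c => c.1 + unitVec (fine n M) c.2) b i‖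
      ≤ d * γ * blockInd n L M (b.1.1 + unitVec (fine n M) b.1.2) i.1.1 :=
    norm_combOp_apply_le n L M hγ hV hG₂' (fun c => c.1 + unitVec (fine n M) c.2) b i
  have h4 : ‖axisOp n L M V G₃ b i‖ ≤ γ * blockInd n L M b.1.1 i.1.1 := norm_axisOp_apply_le n L M hγ hV hG₃ b i
  have hq₁ := blockInd_le_qtwo_left n L M b.1 i.1
  have hq₂ := blockInd_le_qtwo_right n L M b.1 i.1
  have hsum : blockInd n L M b.1.1 i.1.1 + blockInd n L M (b.1.1 + unitVec (fine n M) b.1.2) i.1.1 = (L : ℝ) ^ d * qtwo n L M b.1 i.1 := by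
    rw [qtwo, ← mul_assoc, mul_inv_cancel₀ hL.ne', one_mul]
  have key : d * γ * blockInd n L M b.1.1 i.1.1 + γ * (blockInd n L M b.1.1 i.1.1 + blockInd n L M (b.1.1 + unitVec (fine n M) b.1.2) i.1.1)
      + d * γ * blockInd n L M (b.1.1 + unitVec (fine n M) b.1.2) i.1.1 + γ * blockInd n L M b.1.1 i.1.1
      ≤ (2 * d + 2) * (L : ℝ) ^ d * γ * qtwo n L M b.1 i.1 := by
    rw [hsum]
    calc d * γ * blockInd n L M b.1.1 i.1.1 + γ * ((L : ℝ) ^ d * qtwo n L M b.1 i.1)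
          + d * γ * blockInd n L M (b.1.1 + unitVec (fine n M) b.1.2) i.1.1 + γ * blockInd n L M b.1.1 i.1.1
        ≤ d * γ * ((L : ℝ) ^ d * qtwo n L M b.1 i.1) + γ * ((L : ℝ) ^ d * qtwo n L M b.1 i.1)
          + d * γ * ((L : ℝ) ^ d * qtwo n L M b.1 i.1) + γ * ((L : ℝ) ^ d * qtwo n L M b.1 i.1) :=
          add_le_add (add_le_add (add_le_add (mul_le_mul_of_nonneg_left hq₁ hdγ) le_rfl) (mul_le_mul_of_nonneg_left hq₂ hdγ))
            (mul_le_mul_of_nonneg_left hq₁ hγ)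
      _ = (2 * d + 2) * (L : ℝ) ^ d * γ * qtwo n L M b.1 i.1 := by ring
  have e : Qrem n L M V G₁ G₂ G₃ Rc b i = combOp n L M V G₁ (fun c => c.1) b i + Qstep n L M (fun x r μ s => G₁ x μ r * Smain n L M V x r μ s) b i
      + combOp n L M V (fun x μ r => -(G₂ x μ r * Rc x μ)) (fun c => c.1 + unitVec (fine n M) c.2) b i + axisOp n L M V G₃ b i := by
    simp only [Qrem, Matrix.add_apply]
  rw [e]
  exact le_trans ((norm_add_le _ _).trans (add_le_add ((norm_add_le _ _).trans (add_le_add ((norm_add_le _ _).trans (add_le_add h1 h2)) h3)) h4)) key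

/-- **THE OPERATOR SIZE OF THE ONE-STEP REMAINDER**: `‖Q″(V₀)‖ ≤ card o·2d·(2d+2)L^d·γ·(√(L^d))⁻¹` — the size half of the `E″` datum of `ComposedAveragingRemainder` for ONE step, from the
coefficient letter `γ` (print: `O(L²α₀)`). [cite: Balaban1985Averaging, (139) p.39, (126) p.36] [folklore] -/
theorem opNorm_Qrem_le (hγ : 0 ≤ γ) (hV : ∀ ν b, ‖V ν b‖ ≤ 1) {G₁ G₂ : Tor (fine n M) → Fin d → (Fin d → Fin L) → Matrix o o ℂ}
    {G₃ Rc : Tor (fine n M) → Fin d → Matrix o o ℂ} (hG₁ : ∀ x μ r, ‖G₁ x μ r‖ ≤ γ) (hG₂ : ∀ x μ r, ‖G₂ x μ r‖ ≤ γ) (hG₃ : ∀ x μ, ‖G₃ x μ‖ ≤ γ)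
    (hRc : ∀ x μ, ‖Rc x μ‖ ≤ 1) :
    ‖Qrem n L M V G₁ G₂ G₃ Rc‖ ≤ Fintype.card o * (2 * d * ((2 * d + 2) * (L : ℝ) ^ d * γ)) * (Real.sqrt ((L : ℝ) ^ d))⁻¹ :=
  opNorm_le_of_dominated n L M _ (by positivity) (norm_Qrem_apply_le n L M hγ hV hG₁ hG₂ hG₃ hRc)

/-- the main term is dominated by the free kernel with constant `L^d` in (140)'s currency: `‖Q₀(c,α;b,α′)‖ ≤ L^d·qtwo c b` (so `‖Q₀‖ ≤ card o·2d·L^d·(√(L^d))⁻¹`; the sharp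
`‖√(L^d)Q₀‖ ≤ 1 + card o·τ` is `CovariantTableAveraging.opNorm_QcovT_sub_kron_le`). [cite: Balaban1985Averaging, (139) p.39] [folklore] -/
theorem norm_Qstep_Smain_apply_le (hV : ∀ ν b, ‖V ν b‖ ≤ 1) (b : (Tor (fine n M) × Fin d) × o) (i : (Tor (fine (L * n) M) × Fin d) × o) :
    ‖Qstep n L M (Smain n L M V) b i‖ ≤ (L : ℝ) ^ d * qtwo n L M b.1 i.1 := by
  have h := norm_Qstep_apply_le n L M zero_le_one (S := Smain n L M V) (fun x r μ s => norm_transport_le_one _ hV _ _) b i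
  rw [one_mul] at h
  have hL : (0 : ℝ) < (L : ℝ) ^ d := pow_pos (by exact_mod_cast Nat.pos_of_ne_zero (NeZero.ne L)) d
  refine h.trans (le_of_eq ?_)
  rw [qtwo, ← mul_assoc, mul_inv_cancel₀ hL.ne', one_mul]

end Domination

end Summit.QuantumFields.BalabanUV.T4Continuum.NE2.OneStepRemainder

end
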